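import Literature.MathematicalPhysics.QuantumFieldTheory.Balaban1983to89.B15Prop1LocalChartAtBaseFieldTower
import Literature.MathematicalPhysics.QuantumFieldTheory.Balaban1983to89.B15Prop1DatumCoordinatesTowerB
import Literature.MathematicalPhysics.QuantumFieldTheory.Balaban1983to89.B15Prop1CriticalChartFromIFTB

/-!
# `Balaban1983to89.B15Prop1LocalChartAtBaseFieldTower` — [Balaban1985Variational] = «[15]», Thm 1 p. 279, Sect. C (47)–(48) p. 285, Sect. G pp. 305–309, Prop. 9 (190) p. 309, (181) p. 307; — **BOND-DATUM EDITION** (`…B15Prop1LocalChartAtBaseFieldTowerB`, USED DECLARATIONS ONLY): the print-datum ([Balaban1984PropagatorsII] (2.3)) twins of the declarations of `B15Prop1LocalChartAtBaseFieldTower` that N12's junction of record v14ᴸ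
uses with a datum-bearing statement (`exists_localChart_at_baseField_of_guardOn`) — class (γ) of dag-n12-c's census-by-declaration v2 (bus [DAGN12C-G35], 2026-08-30).  GENERATOR (block-extracted from the
parent's tree bytes by HOME `lean/g35/gen/gen_blocks.py`): namespace `…B`, SAME names, `DetSet ↦ BDetSet` (F0a), `AgreeOn ↦ AgreeOnB`, `IsMinimizer ↦ IsMinimizerB`, `bondsOf (𝐁 j) ↦ 𝔅 j`, `constrCard ∕
constrEnum ∕ ConstrSet ∕ msChart ↦ …B` (lane `Node00/MultiScaleFibreChartB`), `IsCritOnFibre ∕ IsFibreChartNear ↦ …B`; proofs VERBATIM; the parent's other (datum-free) declarations REUSED by `open`.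

statement-level skeleton of published theorems with citation tags; proofs where landed; nothing here is a claim about
the Yang–Mills mass gap

Cell `pub-ymgap` (HUMAN RULINGS D-0062 ∕ D-0149), lane `pub-ymgap-dag-n12-c` g35 (R134 seat (a), N12 = [B15], s1, lane owner); `--kind proof --supports` K1⁹ `stmt-QuantumFields-27364`; count-neutral.
THEOREMS ONLY (0 `def`, 0 `instance`, 0 `sorry`).  HONESTY GUARD (director-ym №338 (5)): PURELY ADDITIVE — the parent stays landed and true on its own text; nothing in it is edited; no displayed
premise of any consumer is deleted or weakened; every hypothesis stays a hypothesis.  Nothing of Bałaban's analysis asserted; N12 NOT discharged; K0⁷ ∕ K1⁹ NOT closed; one finite 𝕋⁴ programme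
at fixed ε — nothing continuum ∕ ℝ⁴ ∕ OS; the Yang–Mills mass gap (Clay) is NOT proved by any of this.

PARENT's DOCSTRING (mathematics and citations; read `𝐁` as the bond datum `𝔅`):
# `Balaban1983to89.B15Prop1LocalChartAtBaseFieldTower` — [Balaban1985Variational] = «[15]», Thm 1 p. 279, Sect. C (47)–(48) p. 285, Sect. G pp. 305–309, Prop. 9 (190) p. 309, (181) p. 307;
# [Balaban1988Convergent] = «[III]», (2.10)–(2.12) p. 256; [Balaban1989LargeFieldI] = «[IV]», Prop. 1 p. 194 (last clause):
# THE LOCAL HOLOMORPHIC MINIMISER CHART AT ONE BASE FIELD UNDER THE PER-TOWER (0.4) GUARDS ONLY — the «TP» twin of `B15Prop1LocalChartAtBaseField` (LOCATED-E1-HSB repair step (r3), link 2∕9)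

Honest framing: statement-level skeleton of published theorems with citation tags; proofs where landed; nothing here is a claim about the
Yang–Mills mass gap.  Cell `pub-ymgap`, HUMAN RULING D-0062 (Track A), seat `pub-ymgap-dag-n12-c` g24 (lane owner N12 = [B15], strategy s1; lane memo `N12-UNIFORMITY-SPEC.md` §6,
plan g91 word pub-ymgap INBOX l.45435 «(r3) = ADDITIVE TP-twins»); count-neutral; N12 NOT discharged; finite 𝕋⁴ at fixed ε; nothing continuum ∕ OS ∕ mass-gap ∕ Clay.

WHAT CHANGES AGAINST THE TWIN (dag-n12-w1 g2's `exists_localChart_at_baseField`, untouched and still serving the small-field readings).  The two displayed GLOBAL guards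
`hsbQ : SmallBelow k Q₀`, `hsbU : SmallBelow k U₀` ((0.4) small at EVERY coarse bond below `k` — false for data rough off `Z`, lane memo §6) are REPLACED by the per-tower guards at the
constrained bonds of `𝔹` (enumerated by `Node00.constrEnum 𝔹 k`, the index of the datum coordinates): `hgQ`∕`hgU : ∀ i, ∀ j′ < j_i, ∀ c′ ∈ bondsIn (j′+1) (blockIter j_i ⁻¹' {c_i₋, c_i₊}),
Small (Ū^{j′} ·) c′` — INHABITED for a (2.12)-class configuration and for the pull-back datum by `Summits/…/BalabanUVNodesN12TowerGuardsOfClass` (step (r2)) — plus the standing range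
`hk : k ≤ m + K`.  The proof is the twin's VERBATIM with the six datum-coordinate facts taken from `B15Prop1DatumCoordinatesTower` (`…_of_guardOn`); `exists_conjCLM_submodule` is the twin's.
Everything else (objects, displayed print-shaped letters `hcrit` ∕ `honto` ∕ `hnondeg` ∕ `hclass` ∕ `hcritT` ∕ `hT1u`, conclusion = the hypothesis `hloc` of
`B15Prop1MinimiserFamilyPatching.hMin_of_localCharts` at this base field) is as in the twin's module docstring.

CONTENTS (theorems only; no `def`, no `instance`, no `sorry`).  ★★★ `exists_localChart_at_baseField_of_guardOn`.
-/


noncomputable section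

namespace Literature.MathematicalPhysics.QuantumFieldTheory.Balaban1983to89.B15Prop1LocalChartAtBaseFieldTowerB

open B15Prop1LocalChartAtBaseFieldTower


open Set Metric Filter
open scoped Topology ContDiff ComplexConjugate
open Literature.Analysis.Calculus.ConstrainedCriticalFamily (symm_equivariant symm_eq_of_equivariant symm_eventuallyEq contDiffAt_symm_iff fderiv_symm_eq
  fderiv_fderiv_symm_eq fderiv_symm_eventuallyEq)
open Literature.MathematicalPhysics.QuantumFieldTheory.Balaban1983to89.Node00 (SU coeField coeField_apply SmallBelow ConstrSetB constrCardB constrEnumB)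
open B15AveragingHolomorphic (iterMh)
open B15ComplexifiedDatumFamily (conjVec conjVec_cplxVec)
open B15SU2ChartHolomorphic (expMulC logCoordC)
open B15Prop1StateChartSU2 (exists_conjCLM exists_conjCLM_pi conjVec_conjVec expMulC_conjVec_coeField det_expMulC_coeField analyticAt_expMulC_right)
open B15Prop1DatumCoordinates (expMulC_zero_left)
open B15Prop1DatumCoordinatesTowerB (datumCoord_coeField_eq_zero_of_agreeOn_of_guardOn eventually_analyticAt_datumCoord_of_guardOn
  eventually_differentiableAt_datumCoord_of_guardOn eventually_datumCoord_real_of_guardOn eventually_datumCoord_theta_of_guardOn eventually_agreeOn_of_datumCoord_eq_of_guardOn)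
open B15Prop1LocalChartAtBaseField (exists_conjCLM_submodule)
open B15Prop1ComplexWilsonAction (analyticAt_actionSum_expMulC actionSum_expMulC_conjVec)
open B15Prop1CriticalChartFromIFTB (exists_localChart_of_criticalFamily_local)
open ExpMeanLog (expMeanLogSU)
open BlockAveraging (blockAvg)
open T4CubeChartGnomonic (SU2)
open T4Continuum B15DeterminingSets B15DeterminingSetsB GaugeField
open scoped Matrix.Norms.L2Operator



section
variable {P : Params}

/-- ★★★ **THE LOCAL HOLOMORPHIC MINIMISER CHART AT ONE BASE FIELD, ON A GAUGE SLICE, UNDER THE PER-TOWER GUARDS ONLY** (TP-twin of `B15Prop1LocalChartAtBaseField.exists_localChart_at_baseField`: `hsbQ`∕`hsbU` ↦ `hgQ`∕`hgU` + `hk`).  See the module docstring for the objects.  Inputs INHABITED here: the state chart, the analytic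
conjugation-symmetric complex action, the analytic locally-conjugation-symmetric logarithmic datum coordinates (symmetrised to global equivariance), their reality and injectivity
near the base, the centring `x₀ = 0`.  Inputs DISPLAYED (print-shaped, per base field): `hcrit` (Lagrange criticality of `U₀` in the slice coordinates), `honto`, `hnondeg` (β),
`hclass` (openness of the class at `U₀`), `hcritT` (criticality transfer), `hT1u` ([15] Thm 1's uniqueness clause).  Output: the hypothesis `hloc` of
`B15Prop1MinimiserFamilyPatching.hMin_of_localCharts` at this base field. [cite: Balaban1985Variational, Thm 1 p.279, Sect. C (47)–(48) p.285, Sect. G pp.305–307, (181) p.307, Prop. 9 (190) p.309; Balaban1988Convergent, (2.10)–(2.12) p.256; Balaban1989LargeFieldI, Prop. 1 p.194 (last clause); LuenbergerYe2008, §10.7 pp.306–307] -/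
theorem exists_localChart_at_baseField_of_guardOn (𝔅 : BDetSet P) (k : ℕ) (h𝔅 : ∀ j, k < j → 𝔅 j = ∅) (reg : Set (GaugeField P 0 SU2))
    {Q₀ U₀ : GaugeField P 0 SU2}
    (hk : k ≤ P.m + P.K)
    (hgQ : ∀ i : Fin (constrCardB 𝔅 k), ∀ j', j' < (((constrEnumB 𝔅 k).symm i).1 : ℕ) → ∀ c' : PBond P (j' + 1),
      c' ∈ B10Eq42TorusConstraint.bondsIn (j' + 1) (B14.Eq22Determines.blockIter (((constrEnumB 𝔅 k).symm i).1 : ℕ) ⁻¹'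
        ({((constrEnumB 𝔅 k).symm i).2.1.src, ((constrEnumB 𝔅 k).symm i).2.1.tgt} : Set (Site P ((constrEnumB 𝔅 k).symm i).1))) →
        BlockAveraging.Small expMeanLogSU (Averaging.iter (fun j => blockAvg (P := P) (j := j) expMeanLogSU) j' Q₀) c')
    (hgU : ∀ i : Fin (constrCardB 𝔅 k), ∀ j', j' < (((constrEnumB 𝔅 k).symm i).1 : ℕ) → ∀ c' : PBond P (j' + 1),
      c' ∈ B10Eq42TorusConstraint.bondsIn (j' + 1) (B14.Eq22Determines.blockIter (((constrEnumB 𝔅 k).symm i).1 : ℕ) ⁻¹'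
        ({((constrEnumB 𝔅 k).symm i).2.1.src, ((constrEnumB 𝔅 k).symm i).2.1.tgt} : Set (Site P ((constrEnumB 𝔅 k).symm i).1))) →
        BlockAveraging.Small expMeanLogSU (Averaging.iter (fun j => blockAvg (P := P) (j := j) expMeanLogSU) j' U₀) c')
    (hU₀ : AgreeOnB 𝔅 (avgFamily (fun j => blockAvg (P := P) (j := j) expMeanLogSU) U₀) (avgFamily (fun j => blockAvg (P := P) (j := j) expMeanLogSU) Q₀))
    -- the gauge slice
    (S : Submodule ℂ (VecField P 0 (EuclideanSpace ℂ (Fin 3)))) (hS : ∀ X ∈ S, conjVec X ∈ S)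
    -- the action and the constraint coordinates on the slice, characterised pointwise
    (a : S → ℂ)
    (ha : ∀ X : S, a X = ∑ p : Plaq P 0, (1 - (expMulC (X : VecField P 0 (EuclideanSpace ℂ (Fin 3))) (coeField U₀) ⟨p.src, p.μ⟩ *
      expMulC (X : VecField P 0 (EuclideanSpace ℂ (Fin 3))) (coeField U₀) ⟨p.src.shift p.μ, p.ν⟩ *
      Matrix.adjugate (expMulC (X : VecField P 0 (EuclideanSpace ℂ (Fin 3))) (coeField U₀) ⟨p.src.shift p.ν, p.μ⟩) *
      Matrix.adjugate (expMulC (X : VecField P 0 (EuclideanSpace ℂ (Fin 3))) (coeField U₀) ⟨p.src, p.ν⟩)).trace / 2))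
    (Φ₀ : S → Fin (constrCardB 𝔅 k) → EuclideanSpace ℂ (Fin 3))
    (hΦ₀ : ∀ (X : S) i, Φ₀ X i = logCoordC (star ((avgFamily (fun j => blockAvg (P := P) (j := j) expMeanLogSU) Q₀ ((constrEnumB 𝔅 k).symm i).1
      ((constrEnumB 𝔅 k).symm i).2.1 : SU2) : Matrix (Fin 2) (Fin 2) ℂ) *
      iterMh ((constrEnumB 𝔅 k).symm i).1 (expMulC (X : VecField P 0 (EuclideanSpace ℂ (Fin 3))) (coeField U₀)) ((constrEnumB 𝔅 k).symm i).2.1))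
    -- DISPLAYED: Lagrange criticality of the base state, «onto», (β) nondegeneracy — in these coordinates
    {ℓ₀ : (Fin (constrCardB 𝔅 k) → EuclideanSpace ℂ (Fin 3)) →L[ℂ] ℂ}
    (hcrit : fderiv ℂ a 0 = ℓ₀.comp (fderiv ℂ Φ₀ 0))
    (honto : Function.Surjective (fderiv ℂ Φ₀ 0))
    (hnondeg : ∀ s : S, fderiv ℂ Φ₀ 0 s = 0 →
      (∀ t : S, fderiv ℂ Φ₀ 0 t = 0 → fderiv ℂ (fderiv ℂ a) 0 s t - ℓ₀ (fderiv ℂ (fderiv ℂ Φ₀) 0 s t) = 0) → s = 0)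
    -- DISPLAYED: the class is open at `U₀`; criticality transfer; [15] Thm 1's uniqueness clause
    (Crit : GaugeField P 0 SU2 → GaugeField P 0 SU2 → Prop)
    (hclass : ∀ᶠ Q in 𝓝 (coeField U₀), ∀ U' : GaugeField P 0 SU2, coeField U' = Q → U' ∈ reg)
    (hcritT : ∀ᶠ w in 𝓝 ((0 : S), coeField Q₀), ∀ (U' Q' : GaugeField P 0 SU2) (μ : (Fin (constrCardB 𝔅 k) → EuclideanSpace ℂ (Fin 3)) →L[ℂ] ℂ),
      expMulC (w.1 : VecField P 0 (EuclideanSpace ℂ (Fin 3))) (coeField U₀) = coeField U' → coeField Q' = w.2 →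
        AgreeOnB 𝔅 (avgFamily (fun j => blockAvg (P := P) (j := j) expMeanLogSU) U') (avgFamily (fun j => blockAvg (P := P) (j := j) expMeanLogSU) Q') →
        fderiv ℂ a w.1 = μ.comp (fderiv ℂ Φ₀ w.1) → Crit Q' U')
    (hT1u : ∀ᶠ Q in 𝓝 (coeField Q₀), ∀ U' Q' : GaugeField P 0 SU2, coeField Q' = Q →
      U' ∈ reg → AgreeOnB 𝔅 (avgFamily (fun j => blockAvg (P := P) (j := j) expMeanLogSU) U') (avgFamily (fun j => blockAvg (P := P) (j := j) expMeanLogSU) Q') →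
        Crit Q' U' → IsMinimizerB (fun j => blockAvg (P := P) (j := j) expMeanLogSU) reg 𝔅 (avgFamily (fun j => blockAvg (P := P) (j := j) expMeanLogSU) Q') U')
    {𝓐₀ : ℝ} (h𝓐₀ : 1 < 𝓐₀) :
    ∃ O : Set (PBond P 0 → Matrix (Fin 2) (Fin 2) ℂ), IsOpen O ∧ coeField Q₀ ∈ O ∧
      ∃ Γ : (PBond P 0 → Matrix (Fin 2) (Fin 2) ℂ) → PBond P 0 → Matrix (Fin 2) (Fin 2) ℂ,
        (∀ b i j, DifferentiableOn ℂ (fun Q => Γ Q b i j) O) ∧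
        (∀ Q ∈ O, ∀ b i j, ‖Γ Q b i j‖ ≤ 𝓐₀) ∧
        ∀ Q' : GaugeField P 0 SU2, coeField Q' ∈ O →
          ∃ U' : GaugeField P 0 SU2, (∀ b, Γ (coeField Q') b = ((U' b : SU2) : Matrix (Fin 2) (Fin 2) ℂ)) ∧
            IsMinimizerB (fun j => blockAvg (P := P) (j := j) expMeanLogSU) reg 𝔅 (avgFamily (fun j => blockAvg (P := P) (j := j) expMeanLogSU) Q') U' := by
  -- abbreviations
  set av : ∀ j, Averaging P j SU2 := fun j => blockAvg (P := P) (j := j) expMeanLogSU with hav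
  set W : MSField P SU2 := avgFamily av Q₀ with hW
  -- the conjugations
  obtain ⟨cE, hcE, hcEinv⟩ := exists_conjCLM_submodule S hS
  obtain ⟨cF, hcF, hcFinv⟩ := exists_conjCLM_pi (Fin (constrCardB 𝔅 k))
  -- the datum coordinates `κ` (pointwise) and their facts at the two base points `Q₀` (datum) and `U₀` (state)
  set κ : (PBond P 0 → Matrix (Fin 2) (Fin 2) ℂ) → Fin (constrCardB 𝔅 k) → EuclideanSpace ℂ (Fin 3) := fun Q i =>
    logCoordC (star ((W ((constrEnumB 𝔅 k).symm i).1 ((constrEnumB 𝔅 k).symm i).2.1 : SU2) : Matrix (Fin 2) (Fin 2) ℂ) *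
      iterMh ((constrEnumB 𝔅 k).symm i).1 Q ((constrEnumB 𝔅 k).symm i).2.1) with hκdef
  have hκ : ∀ Q i, κ Q i = logCoordC (star ((W ((constrEnumB 𝔅 k).symm i).1 ((constrEnumB 𝔅 k).symm i).2.1 : SU2) : Matrix (Fin 2) (Fin 2) ℂ) *
      iterMh ((constrEnumB 𝔅 k).symm i).1 Q ((constrEnumB 𝔅 k).symm i).2.1) := fun Q i => rfl
  have hWQ : AgreeOnB 𝔅 (avgFamily av Q₀) W := fun j b hb => rfl
  have hκQ0 : κ (coeField Q₀) = 0 := datumCoord_coeField_eq_zero_of_agreeOn_of_guardOn 𝔅 k hk W κ hκ hgQ hWQ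
  have hκU0 : κ (coeField U₀) = 0 := datumCoord_coeField_eq_zero_of_agreeOn_of_guardOn 𝔅 k hk W κ hκ hgU hU₀
  -- the state chart on the slice
  set χ : S → PBond P 0 → Matrix (Fin 2) (Fin 2) ℂ := fun X => expMulC (X : VecField P 0 (EuclideanSpace ℂ (Fin 3))) (coeField U₀) with hχdef
  have hχ0 : χ 0 = coeField U₀ := by
    show expMulC ((0 : S) : VecField P 0 (EuclideanSpace ℂ (Fin 3))) (coeField U₀) = coeField U₀
    rw [Submodule.coe_zero, expMulC_zero_left]
  have hχan : ∀ X : S, AnalyticAt ℂ χ X := fun X =>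
    (analyticAt_expMulC_right (coeField U₀) _).comp (S.subtypeL.analyticAt X)
  have hχcont : ContinuousAt χ 0 := (hχan 0).continuousAt
  have hχt : Tendsto χ (𝓝 0) (𝓝 (coeField U₀)) := by
    have h := hχcont.tendsto; rwa [hχ0] at h
  have hχθ : ∀ (X : S) b, χ (cE X) b = (star (χ X b))⁻¹ := fun X b => by
    show expMulC ((cE X : S) : VecField P 0 (EuclideanSpace ℂ (Fin 3))) (coeField U₀) b = _
    rw [hcE]
    exact expMulC_conjVec_coeField U₀ _ b
  have hχdet : ∀ (X : S) b, (χ X b).det = 1 := fun X b => det_expMulC_coeField U₀ _ b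
  have hΦ₀κ : ∀ X : S, Φ₀ X = κ (χ X) := fun X => funext fun i => by rw [hΦ₀, hκ]
  -- local conjugation-equivariance of `Φ₀` near `0` and the symmetrised constraint `Φ`
  have hκθ : ∀ᶠ Q in 𝓝 (coeField U₀), (∀ b, IsUnit (Q b).det) → κ (fun b => (star (Q b))⁻¹) = cF (κ Q) :=
    eventually_datumCoord_theta_of_guardOn 𝔅 k hk W κ hκ hgU hU₀ cF hcF
  have hloc : ∀ᶠ X in 𝓝 (0 : S), Φ₀ (cE X) = cF (Φ₀ X) := by
    filter_upwards [hχt.eventually hκθ] with X hX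
    rw [hΦ₀κ, hΦ₀κ]
    have hunit : ∀ b, IsUnit (χ X b).det := fun b => by rw [hχdet]; exact isUnit_one
    have h := hX hunit
    have hfun : χ (cE X) = fun b => (star (χ X b))⁻¹ := funext (hχθ X)
    rw [hfun]
    exact h
  set Φ : S → Fin (constrCardB 𝔅 k) → EuclideanSpace ℂ (Fin 3) := fun X => (2 : ℂ)⁻¹ • (Φ₀ X + cF (Φ₀ (cE X))) with hΦdef
  have hΦs : ∀ X, Φ X = (2 : ℂ)⁻¹ • (Φ₀ X + cF (Φ₀ (cE X))) := fun X => rfl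
  have hΦE : ∀ X, Φ (cE X) = cF (Φ X) := symm_equivariant cE cF hcEinv hcFinv hΦs
  have hΦeq : Φ =ᶠ[𝓝 0] Φ₀ := symm_eventuallyEq cE cF hcFinv hΦs hloc
  have hΦ0 : Φ 0 = Φ₀ 0 := symm_eq_of_equivariant cE cF hcFinv hΦs hloc.self_of_nhds
  -- regularity of `a` and `Φ₀` at `0`
  have haan : ∀ X : S, AnalyticAt ℂ a X := fun X => by
    have hfun : a = fun X : S => ∑ p : Plaq P 0, (1 - (expMulC (X : VecField P 0 (EuclideanSpace ℂ (Fin 3))) (coeField U₀) ⟨p.src, p.μ⟩ *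
        expMulC (X : VecField P 0 (EuclideanSpace ℂ (Fin 3))) (coeField U₀) ⟨p.src.shift p.μ, p.ν⟩ *
        Matrix.adjugate (expMulC (X : VecField P 0 (EuclideanSpace ℂ (Fin 3))) (coeField U₀) ⟨p.src.shift p.ν, p.μ⟩) *
        Matrix.adjugate (expMulC (X : VecField P 0 (EuclideanSpace ℂ (Fin 3))) (coeField U₀) ⟨p.src, p.ν⟩)).trace / 2) := funext ha
    rw [hfun]
    exact (analyticAt_actionSum_expMulC (P := P) (j := 0) (A := fun W => ∑ p : Plaq P 0, (1 - (W ⟨p.src, p.μ⟩ * W ⟨p.src.shift p.μ, p.ν⟩ *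
      Matrix.adjugate (W ⟨p.src.shift p.ν, p.μ⟩) * Matrix.adjugate (W ⟨p.src, p.ν⟩)).trace / 2)) (fun _ => rfl) U₀ _).comp (S.subtypeL.analyticAt X)
  have haE : ∀ X : S, a (cE X) = conj (a X) := fun X => by
    rw [ha, ha, hcE]
    exact actionSum_expMulC_conjVec (A := fun W => ∑ p : Plaq P 0, (1 - (W ⟨p.src, p.μ⟩ * W ⟨p.src.shift p.μ, p.ν⟩ *
      Matrix.adjugate (W ⟨p.src.shift p.ν, p.μ⟩) * Matrix.adjugate (W ⟨p.src, p.ν⟩)).trace / 2)) (fun _ => rfl) U₀ _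
  have hκan : ∀ᶠ Q in 𝓝 (coeField U₀), AnalyticAt ℂ κ Q := eventually_analyticAt_datumCoord_of_guardOn 𝔅 k hk W κ hκ hgU hU₀
  have hΦ₀an : AnalyticAt ℂ Φ₀ 0 := by
    have hfun : Φ₀ = fun X => κ (χ X) := funext hΦ₀κ
    rw [hfun]
    have h1 : AnalyticAt ℂ κ (χ 0) := by rw [hχ0]; exact hκan.self_of_nhds
    exact h1.comp (hχan 0)
  have ha2 : ContDiffAt ℂ ((1 : WithTop ℕ∞) + 1) a 0 := (haan 0).contDiffAt
  have hΦ2 : ContDiffAt ℂ ((1 : WithTop ℕ∞) + 1) Φ 0 := (contDiffAt_symm_iff cE cF hcFinv hΦs hloc).2 hΦ₀an.contDiffAt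
  -- the IFT data transferred to the symmetrised constraint
  have hD1 : fderiv ℂ Φ 0 = fderiv ℂ Φ₀ 0 := fderiv_symm_eq cE cF hcFinv hΦs hloc
  have hD2 : fderiv ℂ (fderiv ℂ Φ) 0 = fderiv ℂ (fderiv ℂ Φ₀) 0 := fderiv_fderiv_symm_eq cE cF hcFinv hΦs hloc
  have hcrit' : fderiv ℂ a 0 = ℓ₀.comp (fderiv ℂ Φ 0) := by rw [hD1]; exact hcrit
  have honto' : Function.Surjective (fderiv ℂ Φ 0) := by rw [hD1]; exact honto
  have hnondeg' : ∀ s : S, fderiv ℂ Φ 0 s = 0 →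
      (∀ t : S, fderiv ℂ Φ 0 t = 0 → fderiv ℂ (fderiv ℂ a) 0 s t - ℓ₀ (fderiv ℂ (fderiv ℂ Φ) 0 s t) = 0) → s = 0 := by
    rw [hD1, hD2]; exact hnondeg
  -- datum-side facts at `Q₀`
  have hκ₀ : κ (coeField Q₀) = Φ 0 := by rw [hκQ0, hΦ0, hΦ₀κ, hχ0, hκU0]
  have hκd : ∀ᶠ Q in 𝓝 (coeField Q₀), DifferentiableAt ℂ κ Q := eventually_differentiableAt_datumCoord_of_guardOn 𝔅 k hk W κ hκ hgQ hWQ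
  have hκreal : ∀ᶠ Q in 𝓝 (coeField Q₀), ∀ Q' : GaugeField P 0 SU2, coeField Q' = Q → cF (κ Q) = κ Q :=
    eventually_datumCoord_real_of_guardOn 𝔅 k hk W κ hκ hgQ hWQ cF hcF
  -- the localised transfer: class (displayed), fibre (datum-coordinate injectivity), criticality (displayed)
  have hfib := eventually_agreeOn_of_datumCoord_eq_of_guardOn 𝔅 k hk W κ hκ h𝔅 hgU hgQ hU₀ hWQ
  have hpair : Tendsto (fun w : S × (PBond P 0 → Matrix (Fin 2) (Fin 2) ℂ) => (χ w.1, w.2)) (𝓝 ((0 : S), coeField Q₀)) (𝓝 (coeField U₀, coeField Q₀)) := by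
    rw [nhds_prod_eq]
    exact (hχt.comp tendsto_fst).prodMk_nhds tendsto_snd
  have hΦeq' : ∀ᶠ w : S × (PBond P 0 → Matrix (Fin 2) (Fin 2) ℂ) in 𝓝 ((0 : S), coeField Q₀), Φ w.1 = Φ₀ w.1 ∧ fderiv ℂ Φ w.1 = fderiv ℂ Φ₀ w.1 :=
    (hΦeq.and (fderiv_symm_eventuallyEq cE cF hcFinv hΦs hloc)).prod_inl_nhds (coeField Q₀)
  have hclass' : ∀ᶠ w : S × (PBond P 0 → Matrix (Fin 2) (Fin 2) ℂ) in 𝓝 ((0 : S), coeField Q₀), ∀ U' : GaugeField P 0 SU2, coeField U' = χ w.1 → U' ∈ reg :=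
    ((hχt.eventually hclass).prod_inl_nhds (coeField Q₀)).mono fun w hw U' hU' => hw U' hU'
  have htransfer : ∀ᶠ w in 𝓝 ((0 : S), coeField Q₀), ∀ (U' Q' : GaugeField P 0 SU2) (μ : (Fin (constrCardB 𝔅 k) → EuclideanSpace ℂ (Fin 3)) →L[ℂ] ℂ),
      χ w.1 = coeField U' → coeField Q' = w.2 → Φ w.1 = κ w.2 → fderiv ℂ a w.1 = μ.comp (fderiv ℂ Φ w.1) →
        (starL ℂ : ℂ ≃L⋆[ℂ] ℂ).toContinuousLinearMap.comp (μ.comp cF) = μ →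
          U' ∈ reg ∧ AgreeOnB 𝔅 (avgFamily av U') (avgFamily av Q') ∧ Crit Q' U' := by
    filter_upwards [hpair.eventually hfib, hΦeq', hclass', hcritT] with w hfw hΦw hclw hcrw U' Q' μ hU' hQ' hΦκ hlag _
    have hagree : AgreeOnB 𝔅 (avgFamily av U') (avgFamily av Q') := by
      refine hfw U' Q' hU'.symm hQ' ?_
      show κ (χ w.1) = κ w.2
      rw [← hΦ₀κ, ← hΦw.1]; exact hΦκ
    refine ⟨hclw U' hU'.symm, hagree, ?_⟩
    refine hcrw U' Q' μ hU' hQ' hagree ?_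
    rw [← hΦw.2]; exact hlag
  -- assemble
  exact exists_localChart_of_criticalFamily_local av reg 𝔅 cE cF hcEinv hcFinv (m := 1) one_ne_zero (by decide) ha2 hΦ2 hcrit' honto' hnondeg'
    haE hΦE (map_zero cE) χ (Filter.Eventually.of_forall fun X => (hχan X).differentiableAt) hχθ hχdet κ hκ₀ hκd hκreal Crit htransfer hT1u h𝓐₀

end

end Literature.MathematicalPhysics.QuantumFieldTheory.Balaban1983to89.B15Prop1LocalChartAtBaseFieldTowerB

end
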